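import Summits.Ventures.GridStability.Lyapunov.WSCC9LossySlabCast
import Summits.Ventures.GridStability.Lyapunov.WSCC9LossySlabPsd
import Summits.Ventures.GridStability.Lyapunov.WSCC9LossySlabVert1
import Summits.Ventures.GridStability.Lyapunov.WSCC9LossySlabVert2
import HarnessLib

/-!
# GridStability/Lyapunov/WSCC9LossySlab — THE SLAB + POPOV CERTIFICATE for the printed-lossy WSCC9 object
# `WSCC9.lurieSystem` (#35 «G2.c-WSCC9-LOSSY-SLAB», lane V), assembled by lit-6's vertex constructor

Venture GRIDFUSION, lead RULING R-LOSSY-SLAB-ROW + 07:15:04Z / 07:18:16Z (lane V PRIMARY); seat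
gridfusion-lyap-1 (g4). Inputs: `WSCC9LossySlabData/Psd/VertData1–3/Vert1–2/Cast` (sos-2 Λ `2541e15e`,
vertex pack `0d3f30ad`) and lit-6's receptacle `LuriePostnikovSlabCertificate.lean` §5
(`SlabCertificate.ofVertices`, p507810). WHAT IS PROVED: the real blocks `𝓛₀(S)`, `𝓛_lin(B)` are the
casts of the `ℚ` blocks of `WSCC9LossySlabCast` (`slab0_eq`, `slabLin_eq`), hence for every vertex `v`
the receptacle's vertex matrix IS `(Mv v ↦ ℝ)` reindexed (`neg_slab_vertex_eq`) and is `⪰ 0` by the 64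
kernel facts (`vpsd_all`, `hv`); `P − ε·1 ⪰ 0`; THE CERTIFICATE `cert : SlabCertificate
WSCC9.lurieSystem := SlabCertificate.ofVertices …`; and the rank-one facts in `S`-typed form (`rankOne`).
The sector hypothesis, the level and the sentence are `WSCC9LossySlabRoa.lean`.

THREE COLUMNS. CERTIFIED (kernel): the certificate's defining facts for the MODEL `WSCC9.lurieSystem` =
Pai's DIRECTED Lur'e form of M′ = WSCC9-postB-SPdamp-h12 (post-fault-B reduction WITH transfer
conductances, printed damping `D/M = 1/10, 1/5, 3/10`) — the very object of the #24 obstruction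
(`WSCC9LurieObstruction.lean`: the Popov-free quadratic class is EMPTY there; this class is NOT).
VALIDATED: sos-2's solver lineages. MODELLED: as `Models/WSCC9.lean` / `ClassicalSwingLurie.lean`
(MV-2 + MV-P + MV-SPD + MV-h12). No sentence of this file says a grid is stable.
-/

noncomputable section

open Matrix
open Literature.MathematicalPhysics.PowerSystems
open Literature.MathematicalPhysics.PowerSystems.LyapunovFunctionFamily
open Literature.Computation.Certificates
open Summit.Ventures.GridStability.Models
open Summit.Ventures.GridStability.Lyapunov.LurieObstruction

namespace Summit.Ventures.GridStability.Lyapunov.WSCC9LossySlab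

/-! ### The certificate data over `ℝ` -/

/-- `P` (real, typed index). -/
def P : Matrix (Fin 3 ⊕ Fin 2) (Fin 3 ⊕ Fin 2) ℝ := PQ.map (Rat.cast : ℚ → ℝ)
/-- `τ` (real). -/
def τ (k : Fin 3 × Fin 3) : ℝ := (tauK k : ℝ)
/-- `λ` (real). -/
def lam (k : Fin 3 × Fin 3) : ℝ := (lamK k : ℝ)
/-- `a` (real). -/
def a (k : Fin 3 × Fin 3) : ℝ := (aK k : ℝ)
/-- `b` (real). -/
def b (k : Fin 3 × Fin 3) : ℝ := (bK k : ℝ)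
/-- `lo` (real). -/
def lo (j : Fin 6) : ℝ := (loQ j : ℝ)
/-- `hi` (real). -/
def hi (j : Fin 6) : ℝ := (hiQ j : ℝ)

/-! ### Cast plumbing -/

/-- `(M·N) ↦ ℝ` (plumbing). -/
private theorem map_mul' {m n o : Type*} [Fintype n] (M : Matrix m n ℚ) (N : Matrix n o ℚ) :
    (M * N).map (Rat.cast : ℚ → ℝ) = M.map (Rat.cast : ℚ → ℝ) * N.map (Rat.cast : ℚ → ℝ) :=
  Matrix.map_mul (f := Rat.castHom ℝ)

/-- `(M+N) ↦ ℝ` (plumbing). -/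
private theorem map_add' {m n : Type*} (M N : Matrix m n ℚ) :
    (M + N).map (Rat.cast : ℚ → ℝ) = M.map (Rat.cast : ℚ → ℝ) + N.map (Rat.cast : ℚ → ℝ) := by
  ext i j; simp

/-- `(M−N) ↦ ℝ` (plumbing). -/
private theorem map_sub' {m n : Type*} (M N : Matrix m n ℚ) :
    (M - N).map (Rat.cast : ℚ → ℝ) = M.map (Rat.cast : ℚ → ℝ) - N.map (Rat.cast : ℚ → ℝ) := by
  ext i j; simp

/-- `(−M) ↦ ℝ` (plumbing). -/
private theorem map_neg' {m n : Type*} (M : Matrix m n ℚ) :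
    (-M).map (Rat.cast : ℚ → ℝ) = -M.map (Rat.cast : ℚ → ℝ) := by
  ext i j; simp

/-- transpose commutes with the cast (plumbing). -/
private theorem map_transpose' {m n : Type*} (M : Matrix m n ℚ) :
    Mᵀ.map (Rat.cast : ℚ → ℝ) = (M.map (Rat.cast : ℚ → ℝ))ᵀ := rfl

/-- `diag(d) ↦ ℝ` (plumbing). -/
private theorem map_diagonal' {n : Type*} [DecidableEq n] (d : n → ℚ) :
    (Matrix.diagonal d).map (Rat.cast : ℚ → ℝ) = Matrix.diagonal (fun i => (d i : ℝ)) :=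
  Matrix.diagonal_map Rat.cast_zero

/-- `(q·1) ↦ ℝ` (plumbing). -/
private theorem map_smul_one' {n : Type*} [DecidableEq n] (q : ℚ) :
    (q • (1 : Matrix n n ℚ)).map (Rat.cast : ℚ → ℝ) = (q : ℝ) • (1 : Matrix n n ℝ) := by
  ext i j
  by_cases h : i = j
  · subst h; simp
  · simp [h]

/-- `(q·M) ↦ ℝ` (plumbing). -/
private theorem map_smul' {m n : Type*} (q : ℚ) (M : Matrix m n ℚ) :
    (q • M).map (Rat.cast : ℚ → ℝ) = (q : ℝ) • M.map (Rat.cast : ℚ → ℝ) := by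
  ext i j; simp

/-- zero ↦ zero (plumbing). -/
private theorem map_zero' {m n : Type*} : (0 : Matrix m n ℚ).map (Rat.cast : ℚ → ℝ) = 0 := by
  ext i j; simp

/-! ### `𝓛₀` and `𝓛_lin` of the object are the casts -/

/-- `𝓛₀(S.A, S.C, P, η, λ, τ, a, b) = slab0Q ↦ ℝ`. -/
theorem slab0_eq :
    slabMatrix₀ WSCC9.lurieSystem.A WSCC9.lurieSystem.C P (etaQ : ℝ) lam τ a b
      = slab0Q.map (Rat.cast : ℚ → ℝ) := by
  have hd1 : Matrix.diagonal lam = (Matrix.diagonal lamK).map (Rat.cast : ℚ → ℝ) := by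
    rw [map_diagonal']; rfl
  have hd2 : Matrix.diagonal (fun k => τ k * (a k * b k))
      = (Matrix.diagonal (fun k => tauK k * (aK k * bK k))).map (Rat.cast : ℚ → ℝ) := by
    rw [map_diagonal']; congr 1; funext k; simp only [τ, a, b]; push_cast; ring
  have hd3 : Matrix.diagonal (fun k => τ k * (a k + b k) / 2)
      = (Matrix.diagonal (fun k => tauK k * (aK k + bK k) / 2)).map (Rat.cast : ℚ → ℝ) := by
    rw [map_diagonal']; congr 1; funext k; simp only [τ, a, b]; push_cast; ring
  have hd4 : Matrix.diagonal τ = (Matrix.diagonal tauK).map (Rat.cast : ℚ → ℝ) := by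
    rw [map_diagonal']; rfl
  rw [slabMatrix₀, A_eq, C_eq, hd1, hd2, hd3, hd4, P, slab0Q, Matrix.fromBlocks_map]
  simp only [map_sub', map_add', map_mul', map_transpose', map_smul_one', map_neg']

/-- `𝓛_lin(S.C, P, λ; B ↦ ℝ) = slabLinQ B ↦ ℝ`. -/
theorem slabLin_eq (B : Matrix (Fin 3 ⊕ Fin 2) (Fin 3 × Fin 3) ℚ) :
    slabMatrixLin WSCC9.lurieSystem.C P lam (B.map (Rat.cast : ℚ → ℝ))
      = (slabLinQ B).map (Rat.cast : ℚ → ℝ) := by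
  have hd1 : Matrix.diagonal lam = (Matrix.diagonal lamK).map (Rat.cast : ℚ → ℝ) := by
    rw [map_diagonal']; rfl
  rw [slabMatrixLin, C_eq, hd1, P, slabLinQ, Matrix.fromBlocks_map]
  simp only [map_sub', map_mul', map_transpose', map_neg', map_zero']

/-- The receptacle's vertex input is the cast of the `ℚ` vertex input. -/
theorem vertexInput_eq (v : Fin 6 → Bool) :
    (0 + ∑ j, (if v j then hi j else lo j) • Bj j)
      = (∑ j, cv v j • BjQ j).map (Rat.cast : ℚ → ℝ) := by
  rw [zero_add]
  ext i k
  simp only [Matrix.sum_apply, Matrix.smul_apply, Matrix.map_apply, Bj_eq, cv, hi, lo, smul_eq_mul,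
    Rat.cast_sum, Rat.cast_mul]
  refine Finset.sum_congr rfl fun j _ => ?_
  split_ifs <;> rfl

/-- **The receptacle's vertex matrix IS `Mv v ↦ ℝ` (reindexed).** -/
theorem neg_slab_vertex_eq (v : Fin 6 → Bool) :
    -(slabMatrix₀ WSCC9.lurieSystem.A WSCC9.lurieSystem.C P (etaQ : ℝ) lam τ a b
        + slabMatrixLin WSCC9.lurieSystem.C P lam (0 + ∑ j, (if v j then hi j else lo j) • Bj j))
      = ((Mv v).map (Rat.cast : ℚ → ℝ)).submatrix e2 e2 := by
  rw [vertexInput_eq, slabLin_eq, slab0_eq, ← map_add', ← map_neg', negSlabQ_vertex_eq]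
  rfl

/-! ### All 64 vertex facts, and the receptacle hypothesis `hv` -/

/-- The 64 vertex PSD facts of `WSCC9LossySlabVert1/2`, by vertex. -/
theorem vpsd_all (v : Fin 6 → Bool) : ((Mv v).map (Rat.cast : ℚ → ℝ)).PosSemidef := by
  have hv : v = ![v 0, v 1, v 2, v 3, v 4, v 5] := by
    ext i; fin_cases i <;> rfl
  rw [hv]
  cases v 0 <;> cases v 1 <;> cases v 2 <;> cases v 3 <;> cases v 4 <;> cases v 5
  exacts [vpsd_000000, vpsd_000001, vpsd_000010, vpsd_000011, vpsd_000100, vpsd_000101, vpsd_000110, vpsd_000111, vpsd_001000, vpsd_001001, vpsd_001010, vpsd_001011, vpsd_001100, vpsd_001101, vpsd_001110, vpsd_001111, vpsd_010000, vpsd_010001, vpsd_010010, vpsd_010011, vpsd_010100, vpsd_010101, vpsd_010110, vpsd_010111, vpsd_011000, vpsd_011001, vpsd_011010, vpsd_011011, vpsd_011100, vpsd_011101, vpsd_011110, vpsd_011111, vpsd_100000, vpsd_100001, vpsd_100010, vpsd_100011, vpsd_100100, vpsd_100101, vpsd_100110, vpsd_100111, vpsd_101000, vpsd_101001, vpsd_101010,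 vpsd_101011, vpsd_101100, vpsd_101101, vpsd_101110, vpsd_101111, vpsd_110000, vpsd_110001, vpsd_110010, vpsd_110011, vpsd_110100, vpsd_110101, vpsd_110110, vpsd_110111, vpsd_111000, vpsd_111001, vpsd_111010, vpsd_111011, vpsd_111100, vpsd_111101, vpsd_111110, vpsd_111111]

/-- **`hv`**: the receptacle's certificate matrix built with every VERTEX input is `⪯ 0`. -/
theorem hv (v : Fin 6 → Bool) :
    (-(slabMatrix₀ WSCC9.lurieSystem.A WSCC9.lurieSystem.C P (etaQ : ℝ) lam τ a b
        + slabMatrixLin WSCC9.lurieSystem.C P lam (0 + ∑ j, (if v j then hi j else lo j) • Bj j))).PosSemidef := by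
  rw [neg_slab_vertex_eq]
  exact (Matrix.posSemidef_submatrix_equiv e2).2 (vpsd_all v)

/-! ### `P`: symmetry and `P − ε·1 ⪰ 0` -/

/-- `Pᵀ = P`. -/
theorem P_symm : Pᵀ = P := by
  ext i j
  simp only [P, PQ, Matrix.transpose_apply, Matrix.map_apply, Matrix.submatrix_apply]
  rw [Pq_symm]

/-- `P − ε·1 = (Pq − ε·1 ↦ ℝ)` reindexed. -/
theorem P_sub_eq : P - (epsQ : ℝ) • (1 : Matrix (Fin 3 ⊕ Fin 2) (Fin 3 ⊕ Fin 2) ℝ)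
    = ((Pq - epsQ • (1 : Matrix (Fin 5) (Fin 5) ℚ)).map (Rat.cast : ℚ → ℝ)).submatrix e1 e1 := by
  ext i j
  by_cases h : i = j
  · subst h; simp [P, PQ]
  · have h' : e1 i ≠ e1 j := fun he => h (e1.injective he)
    simp [P, PQ, h, h']

/-- **`P − ε·1 ⪰ 0`**. -/
theorem P_ge : (P - (epsQ : ℝ) • (1 : Matrix (Fin 3 ⊕ Fin 2) (Fin 3 ⊕ Fin 2) ℝ)).PosSemidef := by
  rw [P_sub_eq]
  exact (Matrix.posSemidef_submatrix_equiv e1).2 posSemidef_Pe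

/-- `P ⪰ 0` (from `P − ε·1 ⪰ 0`, `ε > 0`). -/
theorem P_psd : P.PosSemidef := by
  have h : P = (P - (epsQ : ℝ) • (1 : Matrix (Fin 3 ⊕ Fin 2) (Fin 3 ⊕ Fin 2) ℝ))
      + (epsQ : ℝ) • (1 : Matrix (Fin 3 ⊕ Fin 2) (Fin 3 ⊕ Fin 2) ℝ) := by abel
  rw [h]
  exact P_ge.add (Matrix.PosSemidef.one.smul (by exact_mod_cast epsQ_pos.le))

/-! ### THE CERTIFICATE -/

/-- **THE SLAB + POPOV CERTIFICATE FOR THE PRINTED-LOSSY WSCC9 OBJECT** (`SlabCertificate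
WSCC9.lurieSystem`), built by lit-6's `SlabCertificate.ofVertices` from: the affine input decomposition
`hB`, the weight-box membership `hw`, the rational data `(P, ε, η, τ, λ, a, b)` of sos-2's Λ `2541e15e`,
`P − ε·1 ⪰ 0`, and the 64 kernel vertex facts `hv`. MODEL: `WSCC9.lurieSystem` (directed Lur'e form of
WSCC9-postB-SPdamp-h12, transfer conductances KEPT, printed damping). No sentence says a grid is stable.
[cite: Pai1981, §2.16 Theorem [18] eqs. (2.63)–(2.64) and §4.7.3 eqs. (4.115)–(4.117); VuTuritsyn2017, §4.2 Lemma 1; BoydVandenberghe2004, §2.3.2 Example 2.10] -/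
def cert : SlabCertificate WSCC9.lurieSystem :=
  SlabCertificate.ofVertices WSCC9.lurieSystem hB hw P (epsQ : ℝ) (etaQ : ℝ) τ lam a b P_symm
    (by exact_mod_cast epsQ_pos) (by exact_mod_cast etaQ_pos) P_ge
    (fun k => by unfold τ tauK; exact_mod_cast tauQ_nonneg _)
    (fun k => by unfold lam lamK; exact_mod_cast lamQ_nonneg _)
    (fun k hk => by
      unfold a aK
      have hk' : 0 < lamQ (eκ k) := by unfold lam lamK at hk; exact_mod_cast hk
      exact_mod_cast aQ_nonneg_of_lamQ_pos _ hk')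
    hv

/-- `cert.P = P`. -/ theorem cert_P : cert.P = P := rfl
/-- `cert.a = a`. -/ theorem cert_a : cert.a = a := rfl
/-- `cert.b = b`. -/ theorem cert_b : cert.b = b := rfl
/-- `cert.ε = ε`. -/ theorem cert_ε : cert.ε = (epsQ : ℝ) := rfl
/-- `cert.lam = λ`. -/ theorem cert_lam : cert.lam = lam := rfl

/-! ### Rank-one facts in `S`-typed form (for the level) -/

/-- `s_k` (real, typed channel index). -/
def s (k : Fin 3 × Fin 3) : ℝ := (sQ (eκ k) : ℝ)

/-- `s_k > 0`. -/
theorem s_pos (k : Fin 3 × Fin 3) : 0 < s k := by unfold s; exact_mod_cast sQ_pos _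

/-- The `C`-rows of the object are the literal rows `Crow` (decided over `ℚ`). -/
theorem CQ_eq_Crow : ∀ k i, CQ k i = Crow (eκ k) (e1 i) := by decide +kernel

/-- `s_k·P − C_kᵀC_k = (Rk (3p+q) ↦ ℝ)` reindexed. -/
theorem rankOne_eq (k : Fin 3 × Fin 3) :
    s k • cert.P - Matrix.vecMulVec (WSCC9.lurieSystem.C k) (WSCC9.lurieSystem.C k)
      = ((Rk (eκ k)).map (Rat.cast : ℚ → ℝ)).submatrix e1 e1 := by
  ext i j
  simp [cert_P, P, PQ, Rk, s, C_eq, Matrix.vecMulVec_apply, CQ_eq_Crow, Matrix.sub_apply,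
    Matrix.smul_apply]

/-- **Rank-one facts** `s_k·P − C_kᵀC_k ⪰ 0` for every channel (active: kernel Gram certificates;
diagonal: `C_k = 0`, `P ⪰ 0`). -/
theorem rankOne (k : Fin 3 × Fin 3) :
    (s k • cert.P - Matrix.vecMulVec (WSCC9.lurieSystem.C k) (WSCC9.lurieSystem.C k)).PosSemidef := by
  by_cases hk : k.1 = k.2
  · -- diagonal channel: `C_k = 0`, `s_k = 1`
    have hC : WSCC9.lurieSystem.C k = 0 := by
      funext i
      rw [C_eq, Matrix.map_apply, CQ_eq_Crow]
      have : ∀ k : Fin 3 × Fin 3, k.1 = k.2 → ∀ i, Crow (eκ k) i = 0 := by decide +kernel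
      rw [this k hk]; simp
    have hs : s k = 1 := by
      have : ∀ k : Fin 3 × Fin 3, k.1 = k.2 → sQ (eκ k) = 1 := by decide +kernel
      simp [s, this k hk]
    rw [hC, hs, one_smul]
    simpa [cert_P] using P_psd
  · rw [rankOne_eq]
    refine (Matrix.posSemidef_submatrix_equiv e1).2 (posSemidef_Rk (eκ k) ?_)
    have : ∀ k : Fin 3 × Fin 3, k.1 ≠ k.2 → eκ k ≠ 0 ∧ eκ k ≠ 4 ∧ eκ k ≠ 8 := by decide +kernel
    exact this k hk

end Summit.Ventures.GridStability.Lyapunov.WSCC9LossySlab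

end
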